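import Summits.QuantumFields.YangMills.Theses.CertificationLength
import Summits.QuantumFields.YangMills.Theorems.ConvexGribovBodyUniformLatticeGapCAFunnel
import Summits.QuantumFields.YangMills.Theorems.ConvexGribovBodyNonSimplyConnectedLatticeGapAdmissibleInstance
import Summits.QuantumFields.YangMills.Theorems.ConvexGribovBodyNonSimplyConnectedLatticeGapStubCellFiniteSizeSmallBeta

/-!
# Crux `CompleteAnalyticityAtLargeScales` (stmt-QuantumFields-16178, route `CertificationLength`) —
# strategist workfile: the NEGATION lens has teeth, and the typed census objects

Crux-strategist `planner-cstrat-stmt-QuantumFields-16178-b1-0`, 2026-08-17.  Companion prose: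
`STRATEGY-CENSUS.md`, `Ideas/forced-defect-negation.md` (crux idea, `Lens: negation`).

The crux (A) quantifies over EVERY compact simple `G` in the tree's sense
(`IsCompactSimpleLieGroup G = IsSimpleCompactGroup G ∧ Nonempty (LatticeRep G)`: connected, non-abelian,
simple Lie algebra — finite centre quotients such as `SO(3)`, `PSU(N)` are admitted; the tree certifies
`isCompactSimpleLieGroup_SO3`, `not_simplyConnectedSpace_SO3`) and asks, at every large `β` and SOME cell
size `b`, the total-variation finite-size condition `FS(r.ρ, β, b, n, ε)` of `OneCertifiedCube.FiniteSizeCriterion`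
UNIFORMLY OVER ALL PAIRS OF EXTERIOR DATA and all cell unions `Y ∋ 0` of the `(4n+1)⁴`-cell cube `Q_n`.

## 1. Negation (destructive teeth on the `π₁(G) ≠ 0` sector)

`ForcedDefectSeparation` (H) types the forced-monopole-line mechanism of
`Cruxes/NonSimplyConnectedLatticeGap/ForcedMonopoleLines.md` (lead c5 of crux 16405; cross-item flag
`FLAG-16178.md` by refuter cruxtri-16405-r1-2) in the EXACT geometry of (A): for some admissible non-simply-connected
`(G, r)` and every window `n ≥ 1` there is `β₀` such that at every `β ≥ β₀` and EVERY cell width `b ≥ 1` some legal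
datum of `FS` — a `[b,2b]`-frame `w`, the full cube `Y = Q_n`, two exteriors agreeing on `Q_n` (the straight
`π₁(G)`-monopole world-line `U^∞` through the central cell vs. the trivial exterior), and a `[0,1]`-valued
measurable cylinder function of the central cell (`1{the central cell is crossed top-to-bottom by a monopole
current segment of length ≥ R(b)}`) — separates the two `γ_{Q_n}`-expectations by at least `1/2`.
Physics-grade status of H: the `π₁(G)`-valued monopole current is closed for EVERY configuration and
lift-independent (lattice Bianchi identity), so the frustrated exterior forces non-trivial flux through every time
slice of `Q_n` surely; the centre-blind `r` makes the Dirac sheet free, so at large `β` (dilute monopoles, line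
tension `τ ≈ c₀β`) the forced line runs straight through the central cell (transverse wander `√(side·e^{−2τ}) ≪ b`)
while thermal loops of length `≥ R ≍ log b` have probability `b⁴(6e^{−c₀β})^R → 0`; the only non-rigorous input is the
tension/diluteness picture (de Forcrand–Jahn 2003, Datta–Gavai 1998, Greensite 2011 §4.4).

`completeAnalyticityAtLargeScales_false_of_forcedDefectSeparation : H → ¬ (A)` is PROVED below (sorry-free):
(A) fixes `(n, ε)` with `ε·M(n) < 1`, `M(n) = (4n+3)⁴ − (4n+1)⁴ ≥ 16`, hence `ε < 1/16 < 1/2`; at `B = 1` and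
`β = max β₀ β₂` it certifies some `b ≥ 1`, which H's datum at `(β, b)` violates.  So (A) AS TYPED is refuted the
moment H is established for ONE admissible `(G, r)` — e.g. `SO(3)` with its defining representation — and the
route's own KILL CRITERION ("a faithful (G, r) whose Wilson theory clusters at large β yet admits exterior fields
with non-vanishing TV influence at every scale") is met on the `π₁ ≠ 0` sector.  Class: MISSTATED; repaired
statement `CompleteAnalyticityAtLargeScalesSC` (binder `SimplyConnectedSpace G →` added; `sc_of_crux`), for which
the forced line drags a centre-vortex sheet of cost `∼ β` per plaquette seen by the faithful `r` and hugs `∂Y`.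

## 2. The census objects (for `STRATEGY-CENSUS.md`; all statements elaborate, glue proved)

* Transfer — the solved sibling IN THE TREE is strong coupling: `stub_cellFiniteSize_smallBeta` gives
  `TVFiniteSize ρ β 1 1 ε` for `|β| < β₁(ε)` (recorded as an `example`); its engine (`smallBeta_influence_le`:
  influence ≤ `K·|β|`, a one-step Dobrushin bound) has no scale parameter and dies at `|β| ≈ 1/K`.
* Strengthen — `BetaStepAtDoubledScale` (S⁺, strengthen-to-induct): the `β`-step at doubled scale
  `FS(β, b) → FS(β + δ', 2b)`, `0 ≤ δ' ≤ δ`, which with the in-tree small-`β` base would reach every `β` by induction.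
* Decomposition — `cruxSC_of_subs : UniformLatticeGapSC → WeakToStrongAtCorrelationScale →
  NoCertificateAtBoundedScaleSC → CompleteAnalyticityAtLargeScalesSC` (PROVED): Sub₁ = the weak-coupling
  volume-uniform lattice mass gap (route ConvexGribovBody's rank-0 target `UniformLatticeGap`, stmt-8778,
  restricted to SC; conversely `(A) ⇒ UniformLatticeGap` is LANDED, `uniformLatticeGap_of_completeAnalyticityAtLargeScales`),
  Sub₂ = weak ⇒ strong mixing at the correlation scale (where the forced-defect barrier lives), Sub₃ = no bounded
  certifying scale (= line `birth`'s Stub 2, M-sized).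
-/

set_option autoImplicit false

noncomputable section

open MeasureTheory
open Literature.MathematicalPhysics.QuantumFieldTheory hiding Site ZdEdge
open Literature.MathematicalPhysics.QuantumLattice

namespace Summit.QuantumFields.YangMills.Cruxes.CompleteAnalyticityAtLargeScales.Strategist

/-! ### The cell geometry of `FiniteSizeCriterion`, named (verbatim sub-terms of the crux) -/

/-- The `(4n+1)⁴` cell indices of the cube `Q_n`: `[-2n, 2n]⁴`. [folklore] -/
def cubeCells (n : ℕ) : Finset (Fin 4 → ℤ) :=
  Fintype.piFinset fun _ : Fin 4 => Finset.Icc (-(2 * ((n : ℕ) : ℤ))) (2 * ((n : ℕ) : ℤ))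

/-- The positively oriented links of the cell with index `y` in the frame `w`. [folklore] -/
def cellLinks (w : Fin 4 → ℤ → ℤ) (y : Fin 4 → ℤ) : Finset (ZdEdge 4) :=
  (Fintype.piFinset fun i : Fin 4 => Finset.Ico (w i (y i)) (w i (y i + 1))) ×ˢ (Finset.univ : Finset (Fin 4))

/-- `w` is a `[b, 2b]`-frame: increments between `b` and `2b` in every direction. [folklore] -/
def IsFrame (b : ℕ) (w : Fin 4 → ℤ → ℤ) : Prop :=
  ∀ i j, w i j + ((b : ℕ) : ℤ) ≤ w i (j + 1) ∧ w i (j + 1) ≤ w i j + 2 * ((b : ℕ) : ℤ)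

section FS

variable {G : Type} [Group G] [TopologicalSpace G] [IsTopologicalGroup G] [CompactSpace G]
  [MeasurableSpace G] [BorelSpace G]

/-- **The total-variation finite-size condition `FS(ρ, β, b, n, ε)`** of `OneCertifiedCube.FiniteSizeCriterion`
(stmt-QuantumFields-8895), verbatim the inner hypothesis of the crux: every `[b,2b]`-frame, every cell union `Y ∋ 0`
of `Q_n`, every two exteriors agreeing on `Q_n`, every `[0,1]`-valued measurable cylinder function of the central
cell — the two `γ_Y`-expectations differ by at most `ε`. [cite: DobrushinShlosman1987] -/
def TVFiniteSize {N : ℕ} (ρ : G →* Matrix (Fin N) (Fin N) ℂ) (β : ℝ) (b n : ℕ) (ε : ℝ) : Prop :=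
  ∀ w : Fin 4 → ℤ → ℤ, IsFrame b w → ∀ Y : Finset (Fin 4 → ℤ), Y ⊆ cubeCells n → (0 : Fin 4 → ℤ) ∈ Y →
    ∀ η η' : LGConfig 4 G, (∀ e ∈ (cubeCells n).biUnion (cellLinks w), η e = η' e) →
    ∀ f : LGConfig 4 G → ℝ, IsCylinder f (cellLinks w 0) → Measurable f → (∀ U, 0 ≤ f U ∧ f U ≤ 1) →
      |(∫ U, f U ∂(ymSpecification ρ β (Y.biUnion (cellLinks w)) η)) -
        ∫ U, f U ∂(ymSpecification ρ β (Y.biUnion (cellLinks w)) η')| ≤ ε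

/-- **A separating datum at `(β, b, n)`**: legal data of `FS` with `Y = Q_n` itself whose two `γ_{Q_n}`-expectations
of some `[0,1]`-valued measurable central-cell cylinder function differ by at least `1/2` (the shape delivered by a
forced `π₁(G)`-monopole world-line through the central cell). [folklore] -/
def SeparatingData {N : ℕ} (ρ : G →* Matrix (Fin N) (Fin N) ℂ) (β : ℝ) (b n : ℕ) : Prop :=
  ∃ w : Fin 4 → ℤ → ℤ, IsFrame b w ∧ ∃ η η' : LGConfig 4 G,
    (∀ e ∈ (cubeCells n).biUnion (cellLinks w), η e = η' e) ∧
    ∃ f : LGConfig 4 G → ℝ, IsCylinder f (cellLinks w 0) ∧ Measurable f ∧ (∀ U, 0 ≤ f U ∧ f U ≤ 1) ∧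
      (1 / 2 : ℝ) ≤ |(∫ U, f U ∂(ymSpecification ρ β ((cubeCells n).biUnion (cellLinks w)) η)) -
        ∫ U, f U ∂(ymSpecification ρ β ((cubeCells n).biUnion (cellLinks w)) η')|

/-- The central cell index `0` lies in `Q_n`. [folklore] -/
theorem zero_mem_cubeCells (n : ℕ) : (0 : Fin 4 → ℤ) ∈ cubeCells n := by
  refine Fintype.mem_piFinset.2 fun i => ?_
  simp only [Pi.zero_apply, Finset.mem_Icc]
  omega

/-- **A separating datum kills the finite-size condition** at the same `(β, b, n)` for every `ε < 1/2`. [folklore] -/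
theorem not_tvFiniteSize_of_separatingData {N : ℕ} (ρ : G →* Matrix (Fin N) (Fin N) ℂ) (β : ℝ) (b n : ℕ)
    {ε : ℝ} (hε : ε < 1 / 2) (h : SeparatingData ρ β b n) : ¬ TVFiniteSize ρ β b n ε := by
  intro hFS
  obtain ⟨w, hw, η, η', hagree, f, hcyl, hmeas, hbd, hgap⟩ := h
  have hle := hFS w hw (cubeCells n) subset_rfl (zero_mem_cubeCells n) η η' hagree f hcyl hmeas hbd
  linarith

end FS

/-- **Admissibility forces `ε < 1/2`**: `M(n) = (4n+3)⁴ − (4n+1)⁴ ≥ 16`, so `ε · M(n) < 1` and `ε ≥ 0` give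
`ε < 1/16 < 1/2`. [folklore] -/
theorem eps_lt_half {n : ℕ} {ε : ℝ} (hε : 0 ≤ ε)
    (hM : ε * ((((4 * n + 3) ^ 4 - (4 * n + 1) ^ 4 : ℕ)) : ℝ) < 1) : ε < 1 / 2 := by
  have hle : (4 * n + 1) ^ 4 ≤ (4 * n + 3) ^ 4 := Nat.pow_le_pow_left (by omega) 4
  push_cast [Nat.cast_sub hle] at hM
  have key : (4 * (n : ℝ) + 3) ^ 4 - (4 * (n : ℝ) + 1) ^ 4
      = 8 * (4 * (n : ℝ) + 1) ^ 3 + 24 * (4 * (n : ℝ) + 1) ^ 2 + 32 * (4 * (n : ℝ) + 1) + 16 := by ring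
  rw [key] at hM
  have hP : (16 : ℝ) ≤ 8 * (4 * (n : ℝ) + 1) ^ 3 + 24 * (4 * (n : ℝ) + 1) ^ 2 + 32 * (4 * (n : ℝ) + 1) + 16 :=
    le_add_of_nonneg_left (by positivity)
  have := mul_le_mul_of_nonneg_left hP hε
  linarith

/-- **The crux, read through the named condition** (definitional unfolding; records that `TVFiniteSize` is the
crux's inner hypothesis byte-for-byte). [folklore] -/
theorem crux_iff_named :
    Summit.QuantumFields.YangMills.Theses.CertificationLength.CompleteAnalyticityAtLargeScales ↔
    ∀ (G : Type) [Group G] [TopologicalSpace G] [IsTopologicalGroup G] [CompactSpace G],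
      IsCompactSimpleLieGroup G → letI : MeasurableSpace G := borel G; haveI : BorelSpace G := ⟨rfl⟩;
      ∀ r : LatticeRep G, ∃ (n : ℕ) (ε : ℝ), 1 ≤ n ∧ 0 ≤ ε ∧
        ε * ((((4 * n + 3) ^ 4 - (4 * n + 1) ^ 4 : ℕ)) : ℝ) < 1 ∧
        ∀ B : ℕ, ∃ β₂ : ℝ, ∀ β : ℝ, β₂ ≤ β → ∃ b : ℕ, B ≤ b ∧ 1 ≤ b ∧ TVFiniteSize r.ρ β b n ε :=
  Iff.rfl

/-! ### 1. Negation: the forced-defect hypothesis and the negative-modulo lemma -/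

/-- **(H) `ForcedDefectSeparation`** — the forced `π₁(G)`-monopole world-line, typed in the geometry of (A): for some
compact simple NON-simply-connected `G` (Borel σ-algebra) and some faithful unitary `r`, for every window `n ≥ 1`
there is `β₀` such that at every `β ≥ β₀` and every cell width `b ≥ 1` a separating datum exists (frustrated vs.
trivial exterior off `Q_n`; `f` = the long-monopole-segment indicator of the central cell).  Physics-grade TRUE for
`(SO(3), defining rep)` at `β` beyond the bulk transition (`ForcedMonopoleLines.md` §§1–3); the one non-rigorous input
is the line-tension/diluteness picture of `ℤ₂` monopoles at large `β_A`. [folklore] -/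
def ForcedDefectSeparation : Prop :=
  ∃ (G : Type) (_ : Group G) (_ : TopologicalSpace G) (_ : IsTopologicalGroup G) (_ : CompactSpace G),
    IsCompactSimpleLieGroup G ∧ ¬ SimplyConnectedSpace G ∧
    (letI : MeasurableSpace G := borel G; haveI : BorelSpace G := ⟨rfl⟩;
      ∃ r : LatticeRep G, ∀ n : ℕ, 1 ≤ n → ∃ β₀ : ℝ, ∀ β : ℝ, β₀ ≤ β → ∀ b : ℕ, 1 ≤ b →
        SeparatingData r.ρ β b n)

/-- **Negative-modulo lemma: `ForcedDefectSeparation → ¬ CompleteAnalyticityAtLargeScales`.**  (A) fixes an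
admissible `(n, ε)`, hence `ε < 1/2`; at `B = 1` it certifies some `b ≥ 1` at `β = max β₀ (β₂ 1)`, where H supplies a
separating datum.  Any proof of H for ONE admissible `(G, r)` refutes the crux as typed (class: misstated — the
`π₁(G) ≠ 0` sector must be excluded). [folklore] -/
theorem completeAnalyticityAtLargeScales_false_of_forcedDefectSeparation (h : ForcedDefectSeparation) :
    ¬ Summit.QuantumFields.YangMills.Theses.CertificationLength.CompleteAnalyticityAtLargeScales := by
  intro hA
  obtain ⟨G, _, _, _, _, hG, -, hsep⟩ := h
  letI : MeasurableSpace G := borel G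
  haveI : BorelSpace G := ⟨rfl⟩
  obtain ⟨r, hr⟩ := hsep
  obtain ⟨n, ε, hn, hε, hM, hB⟩ := hA G hG r
  obtain ⟨β₀, hβ₀⟩ := hr n hn
  obtain ⟨β₂, hβ₂⟩ := hB 1
  obtain ⟨b, -, hb1, hFS⟩ := hβ₂ (max β₀ β₂) (le_max_right _ _)
  exact not_tvFiniteSize_of_separatingData r.ρ (max β₀ β₂) b n (eps_lt_half hε hM)
    (hβ₀ (max β₀ β₂) (le_max_left _ _) b hb1) hFS

/-- H localised at a given admissible group and representation (the shape a disprover would establish for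
`G = SO(3)`), and its packaging into `ForcedDefectSeparation`. [folklore] -/
theorem forcedDefectSeparation_of_at (G : Type) [Group G] [TopologicalSpace G] [IsTopologicalGroup G]
    [CompactSpace G] (hG : IsCompactSimpleLieGroup G) (hπ : ¬ SimplyConnectedSpace G)
    (h : letI : MeasurableSpace G := borel G; haveI : BorelSpace G := ⟨rfl⟩;
      ∃ r : LatticeRep G, ∀ n : ℕ, 1 ≤ n → ∃ β₀ : ℝ, ∀ β : ℝ, β₀ ≤ β → ∀ b : ℕ, 1 ≤ b →
        SeparatingData r.ρ β b n) :
    ForcedDefectSeparation :=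
  ⟨G, inferInstance, inferInstance, inferInstance, inferInstance, hG, hπ, h⟩

/-- **The hypothesis class of H is inhabited by `SO(3)`** (tree: `isCompactSimpleLieGroup_SO3`,
`not_simplyConnectedSpace_SO3`, instances `so3_isTopologicalGroup`, `so3_compactSpace`): H is not vacuous for lack
of groups, and the disprover's target is `SeparatingData` for `SO(3)` in its defining representation. [folklore] -/
example : ∃ (G : Type) (_ : Group G) (_ : TopologicalSpace G) (_ : IsTopologicalGroup G) (_ : CompactSpace G),
    IsCompactSimpleLieGroup G ∧ ¬ SimplyConnectedSpace G ∧ Nonempty (LatticeRep G) := by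
  obtain ⟨G, i1, i2, i3, i4, _, _, hG, hπ, hr⟩ :=
    Summit.QuantumFields.YangMills.Theorems.NonSimplyConnectedLatticeGap.exists_admissible_nonSimplyConnected
  exact ⟨G, i1, i2, i3, i4, hG, hπ, hr⟩

/-! ### The repaired statement (for the route's tenure planner) -/

/-- **(A_SC) `CompleteAnalyticityAtLargeScalesSC`** — the crux with the binder `SimplyConnectedSpace G →` added
(the minimal repair named by the flag: for simply connected `G` and faithful `r` every forced defect drags a
centre-vortex sheet of action `∼ β` per plaquette and is glued to `∂Y`). [folklore] -/
def CompleteAnalyticityAtLargeScalesSC : Prop :=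
  ∀ (G : Type) [Group G] [TopologicalSpace G] [IsTopologicalGroup G] [CompactSpace G],
    IsCompactSimpleLieGroup G → SimplyConnectedSpace G →
    letI : MeasurableSpace G := borel G; haveI : BorelSpace G := ⟨rfl⟩;
    ∀ r : LatticeRep G, ∃ (n : ℕ) (ε : ℝ), 1 ≤ n ∧ 0 ≤ ε ∧
      ε * ((((4 * n + 3) ^ 4 - (4 * n + 1) ^ 4 : ℕ)) : ℝ) < 1 ∧
      ∀ B : ℕ, ∃ β₂ : ℝ, ∀ β : ℝ, β₂ ≤ β → ∃ b : ℕ, B ≤ b ∧ 1 ≤ b ∧ TVFiniteSize r.ρ β b n ε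

/-- The crux as typed implies its simply-connected repair (the converse is what fails). [folklore] -/
theorem sc_of_crux
    (h : Summit.QuantumFields.YangMills.Theses.CertificationLength.CompleteAnalyticityAtLargeScales) :
    CompleteAnalyticityAtLargeScalesSC :=
  fun G _ _ _ _ hG _ => h G hG

/-- The repair, fully inlined (the `--signature` text a tenure planner would file), is the named form. [folklore] -/
theorem sc_iff_inline : CompleteAnalyticityAtLargeScalesSC ↔
    ∀ (G : Type) [Group G] [TopologicalSpace G] [IsTopologicalGroup G] [CompactSpace G], IsCompactSimpleLieGroup G → SimplyConnectedSpace G → letI : MeasurableSpace G := borel G; haveI : BorelSpace G := ⟨rfl⟩; ∀ r : LatticeRep G, ∃ (n : ℕ) (ε : ℝ), 1 ≤ n ∧ 0 ≤ ε ∧ ε * ((((4 * n + 3) ^ 4 - (4 * n + 1) ^ 4 : ℕ)) : ℝ) < 1 ∧ ∀ B : ℕ, ∃ β₂ : ℝ, ∀ β : ℝ, β₂ ≤ β → ∃ b : ℕ, B ≤ b ∧ 1 ≤ b ∧ (∀ w : Fin 4 → ℤ → ℤ, (∀ i j, w i j + ((b : ℕ) : ℤ) ≤ w i (j + 1) ∧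 w i (j + 1) ≤ w i j + 2 * ((b : ℕ) : ℤ)) → ∀ Y : Finset (Fin 4 → ℤ), Y ⊆ (Fintype.piFinset fun _ : Fin 4 => Finset.Icc (-(2 * ((n : ℕ) : ℤ))) (2 * ((n : ℕ) : ℤ))) → (0 : Fin 4 → ℤ) ∈ Y → ∀ η η' : LGConfig 4 G, (∀ e ∈ (Fintype.piFinset fun _ : Fin 4 => Finset.Icc (-(2 * ((n : ℕ) : ℤ))) (2 * ((n : ℕ) : ℤ))).biUnion (fun y : Fin 4 → ℤ => (Fintype.piFinset fun i : Fin 4 => Finset.Ico (w i (y i)) (w i (y i + 1))) ×ˢ (Finset.univ : Finset (Fin 4))), η e = η' e) → ∀ f : LGConfig 4 G → ℝ, IsCylinder f ((fun y : Fin 4 → ℤ => (Fintype.piFinset fun i : Fin 4 => Finset.Ico (w i (y i)) (w i (y i + 1))) ×ˢ (Finset.univ : Finset (Fin 4))) 0) → Measurable f → (∀ U, 0 ≤ f U ∧ f U ≤ 1) → |(∫ U, f U ∂(ymSpecification r.ρ β (Y.biUnion (fun y : Fin 4 → ℤ => (Fintype.piFinset fun i : Fin 4 => Finset.Ico (w i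 (y i)) (w i (y i + 1))) ×ˢ (Finset.univ : Finset (Fin 4)))) η)) - ∫ U, f U ∂(ymSpecification r.ρ β (Y.biUnion (fun y : Fin 4 → ℤ => (Fintype.piFinset fun i : Fin 4 => Finset.Ico (w i (y i)) (w i (y i + 1))) ×ˢ (Finset.univ : Finset (Fin 4)))) η')| ≤ ε) :=
  Iff.rfl

/-! ### 2a. Transfer: the solved sibling in the tree (strong coupling, scale 1) -/

section Transfer

variable {G : Type} [Group G] [TopologicalSpace G] [IsTopologicalGroup G] [CompactSpace G]
  [MeasurableSpace G] [BorelSpace G] [SecondCountableTopology G] [T2Space G]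

/-- **The solved sibling of exactly this step is strong coupling**: the tree's PROVED
`stub_cellFiniteSize_smallBeta` (crux 16405, lead c5) is `FS(ρ, β, b = 1, n = 1, ε)` for `|β| < β₁(ε)` — a one-step
Dobrushin bound (influence `≤ K·|β|`), with no scale parameter to carry it to large `β`. [folklore] -/
example {N : ℕ} (ρ : G →* Matrix (Fin N) (Fin N) ℂ) (hρ : Continuous ρ) (ε : ℝ) (hε : 0 < ε) :
    ∃ β₁ : ℝ, 0 < β₁ ∧ ∀ β : ℝ, |β| < β₁ → TVFiniteSize ρ β 1 1 ε :=
  Summit.QuantumFields.YangMills.Theorems.NonSimplyConnectedLatticeGap.stub_cellFiniteSize_smallBeta G N ρ hρ ε hε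

end Transfer

/-! ### 2b. Strengthen: the `β`-step at doubled scale (S⁺, signature only) -/

/-- **(S⁺) `BetaStepAtDoubledScale`** — strengthen-to-induct: a universal `δ > 0` such that certification at
`(β, b)` propagates to `(β + δ', 2b)` for every `0 ≤ δ' ≤ δ` (asymptotic scaling of the WHOLE conditional structure:
`ξ` at most doubles over a `β`-step `δ`).  With the in-tree small-`β` base it would reach every `β ≥ 0` by induction
on `⌈β/δ⌉`.  Recorded for the census: the step at `b ≍ ξ(β)` is the full non-perturbative RG step uniformly in
boundary data, and the statement is moreover FALSE across a bulk first-order transition on the Wilson axis of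
`(G, r)` (no certificate at any scale at a phase-coexistence `β`). [folklore] -/
def BetaStepAtDoubledScale : Prop :=
  ∃ δ : ℝ, 0 < δ ∧ ∀ (G : Type) [Group G] [TopologicalSpace G] [IsTopologicalGroup G] [CompactSpace G],
    IsCompactSimpleLieGroup G → SimplyConnectedSpace G →
    letI : MeasurableSpace G := borel G; haveI : BorelSpace G := ⟨rfl⟩;
    ∀ (r : LatticeRep G) (n : ℕ) (ε : ℝ), 1 ≤ n → 0 ≤ ε →
      ε * ((((4 * n + 3) ^ 4 - (4 * n + 1) ^ 4 : ℕ)) : ℝ) < 1 →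
      ∀ (β δ' : ℝ), 0 ≤ β → 0 ≤ δ' → δ' ≤ δ → ∀ b : ℕ, 1 ≤ b →
        TVFiniteSize r.ρ β b n ε → TVFiniteSize r.ρ (β + δ') (2 * b) n ε

/-! ### 2c. Decomposition: gap ∧ (weak ⇒ strong at the correlation scale) ∧ (no bounded scale) ⇒ (A_SC) -/

/-- **Sub₁ `UniformLatticeGapSC`** — route ConvexGribovBody's rank-0 target `UniformLatticeGap` (stmt-8778: the
volume-uniform weak-coupling lattice mass gap on the tori `(2S+1)⁴`, every pair of gauge-invariant local observables)
restricted to simply connected `G` and read at the Borel σ-algebra. [folklore] -/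
def UniformLatticeGapSC : Prop :=
  ∀ (G : Type) [Group G] [TopologicalSpace G] [IsTopologicalGroup G] [CompactSpace G],
    IsCompactSimpleLieGroup G → SimplyConnectedSpace G →
    letI : MeasurableSpace G := borel G; haveI : BorelSpace G := ⟨rfl⟩;
    ∀ r : LatticeRep G, ∃ β₀ : ℝ, ∀ β : ℝ, β₀ ≤ β → ∃ m : ℝ, 0 < m ∧ ∃ S₁ : ℕ, ∀ A B : YMSpecies G,
      ∃ C : ℝ, ∀ S t : ℕ, S₁ ≤ S → t ≤ S →
        |latticeConnectedCorr r.ρ β (2 * S + 1) A.F B.F t| ≤ C * Real.exp (-(m * t))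

/-- Sub₁ is implied by the (unrestricted) target `ConvexGribovBody.UniformLatticeGap`. [folklore] -/
theorem uniformLatticeGapSC_of_target (h : Summit.QuantumFields.YangMills.Theses.ConvexGribovBody.UniformLatticeGap) :
    UniformLatticeGapSC := by
  intro G _ _ _ _ hG _
  letI : MeasurableSpace G := borel G
  haveI : BorelSpace G := ⟨rfl⟩
  intro r
  exact h G hG r

/-- … hence by the LANDED funnel `uniformLatticeGap_of_completeAnalyticityAtLargeScales` the crux as typed already
implies Sub₁: the crux is AT LEAST the weak-coupling uniform lattice mass gap (kernel-checked calibration of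
"summit-hard" for this census). [folklore] -/
theorem uniformLatticeGapSC_of_crux
    (h : Summit.QuantumFields.YangMills.Theses.CertificationLength.CompleteAnalyticityAtLargeScales) :
    UniformLatticeGapSC :=
  uniformLatticeGapSC_of_target
    (Summit.QuantumFields.YangMills.Theorems.NonSimplyConnectedLatticeGap.uniformLatticeGap_of_completeAnalyticityAtLargeScales h)

/-- **Sub₂ `WeakToStrongAtCorrelationScale`** — weak ⇒ strong mixing for the Wilson theory of a simply connected
`G` at the correlation scale: admissible `(n, ε)` and a constant `C` such that at every `β`, volume-uniform torus
clustering at rate `m > 0` (the Sub₁ data) yields the TV finite-size condition at some cell size `b ≤ C/m + 1`.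
This is where complete analyticity EXCEEDS the gap: false on the `π₁ ≠ 0` sector and for finite gauge groups
(forced monopole lines / forced thin vortex sheets), plausible for simply connected `G` exactly because centre flux
spreads ('t Hooft); no theorem of this shape exists for any gauge theory at weak coupling. [folklore] -/
def WeakToStrongAtCorrelationScale : Prop :=
  ∀ (G : Type) [Group G] [TopologicalSpace G] [IsTopologicalGroup G] [CompactSpace G],
    IsCompactSimpleLieGroup G → SimplyConnectedSpace G →
    letI : MeasurableSpace G := borel G; haveI : BorelSpace G := ⟨rfl⟩;
    ∀ r : LatticeRep G, ∃ (n : ℕ) (ε C : ℝ), 1 ≤ n ∧ 0 ≤ ε ∧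
      ε * ((((4 * n + 3) ^ 4 - (4 * n + 1) ^ 4 : ℕ)) : ℝ) < 1 ∧ 0 < C ∧
      ∀ (β m : ℝ), 0 < m →
        (∃ S₁ : ℕ, ∀ A B : YMSpecies G, ∃ K : ℝ, ∀ S t : ℕ, S₁ ≤ S → t ≤ S →
            |latticeConnectedCorr r.ρ β (2 * S + 1) A.F B.F t| ≤ K * Real.exp (-(m * t))) →
        ∃ b : ℕ, 1 ≤ b ∧ (b : ℝ) ≤ C / m + 1 ∧ TVFiniteSize r.ρ β b n ε

/-- **Sub₃ `NoCertificateAtBoundedScaleSC`** — no bounded scale certifies deep in weak coupling (line `birth`'s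
Stub 2 = support `CertificationLengthDiverges` with the group binders it needs; Laplace concentration + an unscreened
abelian flux at scales `≪ ξ(β)`; M-sized). [folklore] -/
def NoCertificateAtBoundedScaleSC : Prop :=
  ∀ (G : Type) [Group G] [TopologicalSpace G] [IsTopologicalGroup G] [CompactSpace G],
    IsCompactSimpleLieGroup G → SimplyConnectedSpace G →
    letI : MeasurableSpace G := borel G; haveI : BorelSpace G := ⟨rfl⟩;
    ∀ (r : LatticeRep G) (n : ℕ) (ε : ℝ), 1 ≤ n → 0 ≤ ε →
      ε * ((((4 * n + 3) ^ 4 - (4 * n + 1) ^ 4 : ℕ)) : ℝ) < 1 →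
      ∀ B : ℕ, ∃ β₂ : ℝ, ∀ β : ℝ, β₂ ≤ β → ∀ b : ℕ, 1 ≤ b → b ≤ B → ¬ TVFiniteSize r.ρ β b n ε

/-- **The best typed split, glued (sorry-free): Sub₁ → Sub₂ → Sub₃ → (A_SC).**  Gap at every `β ≥ β₀` (Sub₁) fed to
weak⇒strong (Sub₂) certifies SOME `b ≥ 1` at every `β ≥ β₀`; Sub₃ pushes that scale beyond every bound `B`.  Which
piece remains the whole crux: Sub₁ is the summit's declared open lattice core (stmt-8778; seven leads on its `π₁ ≠ 0`
restriction 16405 found no line), and Sub₂ is open-problem-hard on its own. [folklore] -/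
theorem cruxSC_of_subs (h₁ : UniformLatticeGapSC) (h₂ : WeakToStrongAtCorrelationScale)
    (h₃ : NoCertificateAtBoundedScaleSC) : CompleteAnalyticityAtLargeScalesSC := by
  intro G _ _ _ _ hG hSC
  letI : MeasurableSpace G := borel G
  haveI : BorelSpace G := ⟨rfl⟩
  intro r
  obtain ⟨β₀, hgap⟩ := h₁ G hG hSC r
  obtain ⟨n, ε, C, hn, hε, hM, hC, hws⟩ := h₂ G hG hSC r
  refine ⟨n, ε, hn, hε, hM, fun B => ?_⟩
  obtain ⟨β₂, hnone⟩ := h₃ G hG hSC r n ε hn hε hM B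
  refine ⟨max β₀ β₂, fun β hβ => ?_⟩
  obtain ⟨m, hm, hclus⟩ := hgap β (le_trans (le_max_left _ _) hβ)
  obtain ⟨b, hb1, -, hFS⟩ := hws β m hm hclus
  refine ⟨b, ?_, hb1, hFS⟩
  by_contra hBb
  exact hnone β (le_trans (le_max_right _ _) hβ) b hb1 (le_of_lt (not_le.mp hBb)) hFS

end Summit.QuantumFields.YangMills.Cruxes.CompleteAnalyticityAtLargeScales.Strategist
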